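import Summits.QuantumFields.YangMills.Theorems.BalabanUVNodesN21ShellSplitOfRecord13CoPHStatDilation
import Summits.QuantumFields.BalabanUV.T4Continuum.Support.ShellMeasureScalingSUN
import Summits.QuantumFields.BalabanUV.T4Continuum.Support.ShellMeasureExpHaarClosedBallSUN

/-!
# N21 (NE7c) · JUNCTION №3: THE BLOCK FIBRE LAW OF RECORD THROUGH THE EXPONENTIAL `SU(N)` BLOCK CHART — dag-n21-d's ONE displayed estimate
# per (run, K, t, top cube a, exterior x), `SlotAntiConcentration (blockFibreLawOfDatum₉ … b x) (blockReading u b x) θ ρ D` (FILE 6 ★★★★), FOLLOWS from a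
# WINDOW FACTORISATION of the fibre density about a chart centre + the SAME (M1) for the CHART LAW on the FLAT block chart space `BlockChartSU N b = b → ℝ^{d_N}`
# (pub-balaban `T4ShellMeasureDet.slotAntiConcentration_of_chart` ∘ `ShellMeasureScalingSUN.chart_suN` ∘ `ShellMeasureExpHaarClosedBallSUN.haar_restrict_expBallSU_le` BY NAME)
# — the frame in which road II (G28 ∕ G31 ∕ G34, p587240) and the hazard road speak; then dag-n21-d's END with chart-level (M1) in the dilation shape

Track A of `YM-PLAN.md` (cell `pub-ymgap`, HUMAN RULING D-0062 ∕ D-0149 width seats), node **N21**; WIDTH SEAT `pub-ymgap-dag-n21-w2` (gen 0), W-SEAT-START-LIST §n21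
ITEM 2, file 9 (junction №3).  THEOREMS ONLY: 0 `def`, 0 `sorry`; COUNT-NEUTRAL; `--kind proof --supports stmt-QuantumFields-20544 --as helper`.  Imports my junction №2
`…N21ShellSplitOfRecord13CoPHStatDilation` (p598391; brings dag-n21-d's FILE 6 `…Stat`, n20-d's readings, p583987) and pub-balaban's `SU(N)` chart modules
`Support/ShellMeasureScalingSUN` (`windowSU`, `chart_suN`, `BlockChartSU`, `expFibreChartSU`, `chartWeightSU`) + `Support/ShellMeasureExpHaarClosedBallSUN` (`haar_restrict_expBallSU_le`,
`expJacWeightSU`, `kappaSU`).  NO Theses import.  Restates nothing; cites by name.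

WHY.  dag-n21-d's FILE 6 leaves ONE estimate per fibre: (M1) for the block fibre law `(∏_{b} Haar)·cubeDensity(x[b := y])` on `(SU N)^{b}`.  The dilation ∕ hazard roads
prove (M1) on FLAT product frames.  pub-balaban's chart identity (`chart_suN`: the product Haar law restricted to the exponential windows about a centre `c` IS the push-forward of
Lebesgue on the block chart ball weighted by `∏ κ_N·expJac`) transports (M1) from the chart law to the block law whenever the fibre density FACTORS THROUGH THE WINDOW
(`density(x[b := y]) = windowSU b c S y · R y`: the density vanishes off the windows about `c` — for Bałaban's dressed density this is the small-field characteristic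
functions' job, a located letter).  So the N21 residual moves, BY NAME, from «(M1) on a group-valued fibre» to «window factorisation + (M1) on a flat chart law».

WHAT IS PROVED ([bookkeeping]; one application of the chart transport).
* §0 `measurable_blockReading` — a block reading of a measurable statistic is measurable (`measurable_updateFinset` at the definition's `Classical.decEq`).
* ★★ `slotAC_blockFibreLaw_of_chartAC` — ONE FIBRE: if `blockFibreLawOfDatum₉ … t a b x = (blockLaw b).withDensity (windowSU b c S · R)` (the window factorisation, AS A LAW
  IDENTITY — displayed) and the chart law `vol.withDensity (chartWeightSU b S (expJacWeightSU κ_N) · R ∘ expFibreChartSU b c)` satisfies (M1) for the statistic read in the chart,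
  then the block fibre law satisfies (M1) for `blockReading u b x`, SAME constants (`0 ≤ S ≤ π`).
* ★★ `slotAC_termFibreLaw_of_chartAC` — the same ONE-TERM form at dag-n21-d's per-history fibre law `termFibreLawOfDatum₉ … t s b x` (FILE 7 ∕ Defs v1.2; their suggested socket).
* USE (not re-stated as one theorem — the 2 × 7 dependent binder families per run exceed the default elaboration budget): dag-n21-d's END ★★★★ ∕ my p598391
  `shellWeightBound_crOfRecord₁₃At_shellSplit_of_blockFibreAC(_dilation)` take their per-fibre binder as
  `fun K t ht a x => slotAC_blockFibreLaw_of_chartAC F N θ.toStage9Params (datumOfRecord₁₃CoPH F N θ hP) g₀ os (runA₁₃ F K₀ g₀ K) (histA₁₃ θ K₀ g₀ K) (K₀ + K) t a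
  (inputBlock F θ.ν (histA₁₃ θ K₀ g₀ K) a) x hS hSπ c hR hlaw (measurable_blockReading (measurable_cubeStat … hU a) _ x) hchart` (run B alike) — chart data per fibre.

HONEST FRAMING.  The window factorisation of the dressed fibre density and the chart-level (M1) are HYPOTHESES (located: the former is the small-field letters' window, the
latter is where G28∕G31∕G34 ∕ the hazard road ∕ n21-w1's numeral ∕ n21-w3's `hRT` must be instantiated — NOT done here); `hsel`, (H-U), (H-ζ), `0 ≤ ζ`, widths, polynomial
letters HYPOTHESES; `jcut` displayed; K0⁷ OPEN; nothing of Bałaban's asserted; NE7c NOT PRINTED ∕ NOT proved; **N21 NOT discharged**; K3⁷ NOT claimed; counts UNMOVED (typed 28∕28 ·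
discharged 5∕27); one finite four-torus programme at fixed `ε` — NOT ℝ⁴, NOT infinite volume, NOT OS, NOT a mass gap, NOT Clay.  No decl below carries a cite tag.
-/

set_option autoImplicit false

open scoped BigOperators ENNReal
open Finset MeasureTheory Function

namespace Summit.QuantumFields.YangMills.Theorems.N21DilationRoadAtRecord13CoPH

open Literature.MathematicalPhysics.QuantumFieldTheory.Balaban1983to89
open Literature.MathematicalPhysics.QuantumFieldTheory.Balaban1983to89.T4Continuum
open Literature.MathematicalPhysics.QuantumFieldTheory.Balaban1983to89.Node00
open T4ShellMeasure (SlotAntiConcentration)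
open T4ShellMeasureDet (blockLaw slotAntiConcentration_of_chart)
open T4IndicatorShell (ShellWeightBound)
open YMDAG.UVSplit (crOfRecord₁₃At crOfRecord₁₃VAt ShellSplit₁₃CoPH runA₁₃ runB₁₃ histA₁₃ histB₁₃)
open N21ShellSplitOfRecord13CoPH (WidthLetter₁₃CoPH shellSplitOfRecord₁₃At cubeStat inputBlock blockReading blockFibreLawOfDatum₉ termFibreLawOfDatum₉ measurable_cubeStat)
open Summit.QuantumFields.BalabanUV.T4Continuum.ShellMeasureExpChartSUN (SUN BlockChartSU expFibreChartSU measurable_expFibreChartSU chartWeightSU measurable_chartWeightSU)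
open Summit.QuantumFields.BalabanUV.T4Continuum.ShellMeasureScalingSUN (windowSU measurable_windowSU chart_suN)
open Summit.QuantumFields.BalabanUV.T4Continuum.ShellMeasureExpJacobianSUN (expJacWeightSU measurable_expJacWeightSU)
open Summit.QuantumFields.BalabanUV.T4Continuum.ShellMeasureExpHaarAreaSUN (kappaSU)
open Summit.QuantumFields.BalabanUV.T4Continuum.ShellMeasureExpHaarClosedBallSUN (haar_restrict_expBallSU_le)

/-! ## §0 measurability of a block reading -/

/-- a block reading of a measurable statistic is measurable (`measurable_updateFinset`, at the definition's own `Classical.decEq`). [folklore] -/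
theorem measurable_blockReading {N : ℕ} {P : Params} {j : ℕ} {u : GaugeField P j (SU N) → ℝ} (hu : Measurable u) (b : Finset (PBond P j))
    (x : GaugeField P j (SU N)) : Measurable (blockReading N u b x) := by
  letI := Classical.decEq (PBond P j)
  unfold blockReading
  exact hu.comp measurable_updateFinset

/-! ## §1 One fibre: the block fibre law of record through the exponential block chart -/

section OneFibre

variable (F : T4Family) (N : ℕ) [NeZero N] (ϑ : Stage9Params F N) (D : FiniteEpsData F (SU N)) (g₀ : ℕ → ℝ) (os : List (ULoop F))
  (p : B12.RunParams) (g : ℕ → ℝ) (k : ℕ)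

/-- ★★ **(M1) FOR THE BLOCK FIBRE LAW OF RECORD FROM (M1) FOR ITS CHART LAW.**  One truncated-law fibre (source `t`, top cube `a`, block `b`, exterior `x`): IF the block
fibre law factors through the exponential windows of radius `S ∈ [0, π]` about a chart centre `c` with a measurable block weight `R` — as the LAW IDENTITY
`blockFibreLawOfDatum₉ … t a b x = (blockLaw b).withDensity (fun y => windowSU b c S y * R y)` — and the CHART LAW `vol.withDensity (chartWeightSU b S (expJacWeightSU κ_N) · (R ∘ expFibreChartSU b c))`
on the flat block chart space satisfies (M1) for the statistic read in the chart, THEN the block fibre law satisfies (M1) for `blockReading u b x`, same `θ ρ D`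
(`slotAntiConcentration_of_chart` at pub-balaban's chart identity `chart_suN` ∘ `haar_restrict_expBallSU_le`). [bookkeeping] -/
theorem slotAC_blockFibreLaw_of_chartAC (t : ℝ)
    (a : ↥(cubeIndices (F.P p.K) (cubeSide (F.P p.K).L ϑ.ν.M₂ (RkOfRecord (F.P p.K).L ϑ.ν.r (g k)) k)))
    (b : Finset (PBond (F.P p.K) k)) (x : GaugeField (F.P p.K) k (SU N))
    {S : ℝ} (hS : 0 ≤ S) (hSπ : S ≤ Real.pi) (c : GaugeField (F.P p.K) k (SU N))
    {R : (↥b → SU N) → ℝ≥0∞} (hR : Measurable R)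
    (hlaw : blockFibreLawOfDatum₉ F N ϑ D g₀ os p g k t a b x = (blockLaw b).withDensity fun y => windowSU b c S y * R y)
    {u : GaugeField (F.P p.K) k (SU N) → ℝ} (hu : Measurable (blockReading N u b x)) {θ ρ Dc : ℝ}
    (hchart : SlotAntiConcentration
      ((volume : Measure (BlockChartSU N b)).withDensity fun z => chartWeightSU b S (expJacWeightSU (kappaSU N)) z * R (expFibreChartSU b c z))
      (blockReading N u b x ∘ expFibreChartSU b c) θ ρ Dc) :
    SlotAntiConcentration (blockFibreLawOfDatum₉ F N ϑ D g₀ os p g k t a b x) (blockReading N u b x) θ ρ Dc := by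
  rw [hlaw]
  exact slotAntiConcentration_of_chart (blockLaw b) volume (measurable_expFibreChartSU b c)
    (measurable_chartWeightSU b S (measurable_expJacWeightSU (kappaSU N))) (measurable_windowSU b c S)
    (chart_suN b c hS (measurable_expJacWeightSU (kappaSU N)) (haar_restrict_expBallSU_le hSπ)) hR hu hchart

end OneFibre

/-! ## §2 One TERM fibre (dag-n21-d's FILE 7 `termFibreLawOfDatum₉`, v1.2 Defs): the same chart transport per (2.18) history -/

section OneTerm

variable (F : T4Family) (N : ℕ) [NeZero N] (ϑ : Stage9Params F N) (D : FiniteEpsData F (SU N)) (g₀ : ℕ → ℝ) (os : List (ULoop F))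
  (p : B12.RunParams) (g : ℕ → ℝ) (k : ℕ)

/-- ★★ **(M1) FOR ONE HISTORY's FIBRE LAW FROM (M1) FOR ITS CHART LAW** (dag-n21-d g9's suggested socket, l.≈27690: the per-TERM law `termFibreLawOfDatum₉ … t s b x` —
ONE (2.18) history's dressed integrand with the exterior frozen — is where the window factorisation about that history's background is natural): law identity
`termFibreLawOfDatum₉ … t s b x = (blockLaw b).withDensity (windowSU b c S · R)` + (M1) for the chart law ⇒ (M1) for the term fibre law and `blockReading u b x`, same constants.
[bookkeeping] -/
theorem slotAC_termFibreLaw_of_chartAC (t : ℝ) (s : SeqOfRecord F ϑ.ν ϑ.τ9.M g p.K k)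
    (b : Finset (PBond (F.P p.K) k)) (x : GaugeField (F.P p.K) k (SU N))
    {S : ℝ} (hS : 0 ≤ S) (hSπ : S ≤ Real.pi) (c : GaugeField (F.P p.K) k (SU N))
    {R : (↥b → SU N) → ℝ≥0∞} (hR : Measurable R)
    (hlaw : termFibreLawOfDatum₉ F N ϑ D g₀ os p g k t s b x = (blockLaw b).withDensity fun y => windowSU b c S y * R y)
    {u : GaugeField (F.P p.K) k (SU N) → ℝ} (hu : Measurable (blockReading N u b x)) {θ ρ Dc : ℝ}
    (hchart : SlotAntiConcentration
      ((volume : Measure (BlockChartSU N b)).withDensity fun z => chartWeightSU b S (expJacWeightSU (kappaSU N)) z * R (expFibreChartSU b c z))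
      (blockReading N u b x ∘ expFibreChartSU b c) θ ρ Dc) :
    SlotAntiConcentration (termFibreLawOfDatum₉ F N ϑ D g₀ os p g k t s b x) (blockReading N u b x) θ ρ Dc := by
  rw [hlaw]
  exact slotAntiConcentration_of_chart (blockLaw b) volume (measurable_expFibreChartSU b c)
    (measurable_chartWeightSU b S (measurable_expJacWeightSU (kappaSU N))) (measurable_windowSU b c S)
    (chart_suN b c hS (measurable_expJacWeightSU (kappaSU N)) (haar_restrict_expBallSU_le hSπ)) hR hu hchart

end OneTerm

end Summit.QuantumFields.YangMills.Theorems.N21DilationRoadAtRecord13CoPH
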